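import Mathlib.Analysis.Calculus.ContDiff.Bounds
import Mathlib.Analysis.Calculus.MeanValue
import Mathlib.Analysis.Normed.Lp.lpSpace
import Mathlib.Analysis.Asymptotics.Lemmas
import HarnessLib

/-!
# A `C^∞`-bounded family `Y → C_c^∞(M, E)` is ONE `C_c^∞` map `M → ℓ^∞(Y, E)`
# (Hörmander ALPDO I §1.1–§2.1: uniform bounds on all derivatives of a family of test functions ∕ differentiation of Banach-valued maps)

Topic `Analysis/Calculus`; namespace `Literature.Analysis.Calculus`.  THEOREMS ONLY (no `def`, no instance, no axiom, no `sorry`).  Generic calculus, written for the (I₁)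
«bounded jets» clause of Bouaziz's orbital-family letter L1 (cell `pub/hodgecm-mathlib`, crux H413, line LH3, brick (B2a) of LH7-p04 (g4)'s (I₁-CENSUS), RULING #15 of
LH3-plan (g3); count-neutral): the rank-one engine ★ `RankOneCasimir.exists_forall_eventually_norm_iteratedDeriv_orbitalIntegral_comp_clm_le` (p850750 §4) bounds the jets of
the orbital-integral family `F (ℓ ∘ G)` by `‖ℓ‖ · B` for ONE Banach-valued test function `G : M₂(ℂ) → E′` and ALL `ℓ : E′ →L[ℝ] E` at once; to make it UNIFORM over a family
`y ↦ g_y` of test functions that is merely BOUNDED in `y` (no topology on `Y` — the punctured boxes of the (X) cross-place corners), read the family as one map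
`G : M → ℓ^∞(Y, E)` (Mathlib `lp (fun _ : Y => E) ∞`, a Banach space when `E` is) and take `ℓ = ev_y` (norm `≤ 1`).
* §1 `exists_eval_clm_lpInfty` (the evaluation `ev_y : ℓ^∞(Y, E) →L[ℝ] E`, `‖ev_y‖ ≤ 1`), `exists_lpInfty_of_uniform_bound` (a family of maps bounded uniformly in `(y, x)` is
  a map `M → ℓ^∞(Y, E)`, with the norm read-back `‖G x‖ ≤ B₀`), `exists_swap_clm_lpInfty` (the slot swap `ℓ^∞(Y, M →L E) →L (M →L ℓ^∞(Y, E))`, norm `≤ 1`).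
* §2 `norm_sub_sub_fderiv_le_of_norm_iteratedFDeriv_two_le` — the second-order Taylor remainder `‖f(x+h) − f(x) − Df(x) h‖ ≤ B₂ ‖h‖²` from `‖D² f‖ ≤ B₂` (Mathlib mean value
  inequality twice); `norm_fderiv_sub_fderiv_le_of_norm_iteratedFDeriv_two_le` (`Df` is `B₂`-Lipschitz).
* §3 **`exists_contDiff_lpInfty_of_uniform_bounds`** (graded engine, induction on the order with the target universally quantified: each `g y ∈ C^{n+1}` with jets of order
  `≤ n+1` bounded uniformly in `(y, x)` ⇒ `G ∈ Cⁿ(M, ℓ^∞(Y, E))`, `fderiv G = Φ ∘ Ĝ′` with `Ĝ′` the packaged DERIVATIVE family), `exists_contDiff_lpInfty_of_uniform_bounds_infty`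
  (`C^∞`), HEAD **`exists_contDiff_hasCompactSupport_lpInfty_of_uniform_bounds`** (+ `HasCompactSupport G` when the `g y` vanish off one compact `K`, + `ev_y ∘ G = g y`, + norm
  read-back), `exists_uniform_bounds_of_tsupport_subset` (bounds on `K ⊇ tsupport (g y)` suffice) and the `K`-local corollary `exists_contDiff_hasCompactSupport_lpInfty_of_bounds_on`.
UNIVERSE: the induction changes the target (`E ↦ M →L[ℝ] E`), so `Y M E : Type u` live in ONE universe (all tree uses are in `Type`), as in ★ `MixedPartialDerivWithin`.
No completeness hypothesis here; the consumer adds `[CompleteSpace E]` (⇒ `CompleteSpace ℓ^∞(Y, E)`, Mathlib `lp.instCompleteSpace`) only at the §4 call.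
HONEST LABEL: generic calculus; HC_CM is proved only modulo the 7 printed citations (2 remaining: hLiu418 = stmt-HodgeConjecture-24832, h413 = stmt-HodgeConjecture-24833)
until rung 0 closes.

## References
* [HormanderALPDO1] L. Hörmander, *The Analysis of Linear Partial Differential Operators I*, 2nd ed. (1990), §1.1 pp. 7–12 (Thm. 1.1.9: Taylor's formula with uniform remainder),
  §2.1 (the seminorms `sup |∂^α φ|` of a bounded set of test functions).
* [Coleman2012] R. Coleman, *Calculus on Normed Vector Spaces*, Universitext (2012), §3.2 (mean value inequality), §4.5 (higher differentials).

## Mathlib ∕ tree search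
Mathlib: `lp`, `memℓp_infty`, `lp.norm_le_of_forall_le`, `lp.norm_apply_le_norm`, `Convex.norm_image_sub_le_of_norm_fderiv_le`, `hasFDerivAt_iff_isLittleO_nhds_zero`,
`Asymptotics.isLittleO_norm_pow_id`, `contDiff_succ_iff_hasFDerivAt`, `norm_iteratedFDeriv_fderiv`; no `ContDiff`∕`HasFDerivAt` statement into `lp` exists (`lean search
'ContDiff.*lp |HasFDerivAt.*lp \(|Memℓp.*fderiv'`: none).  Tree: ★ CURRY-∞ `exists_contDiff_curry_circle_smul` (p850802) is the CONTINUOUS-parameter lane (`K →ᵇ E`); this file is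
the bounded-parameter lane.
-/

set_option autoImplicit false

noncomputable section

open Set Filter Topology Function Asymptotics
open scoped ContDiff ENNReal

namespace Literature.Analysis.Calculus

universe u

/-! ## §1 Packaging: evaluation, bounded families as `ℓ^∞`-valued maps, the slot swap -/

section Packaging

variable {Y M E : Type u} [NormedAddCommGroup M] [NormedSpace ℝ M] [NormedAddCommGroup E] [NormedSpace ℝ E]

omit [NormedAddCommGroup M] [NormedSpace ℝ M] [NormedSpace ℝ E] in
/-- A pointwise-bounded family of vectors is an element of `ℓ^∞(Y, E)` (Mathlib `memℓp_infty`). [cite: HormanderALPDO1, §2.1] -/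
theorem memℓp_infty_of_forall_norm_le {v : Y → E} {B : ℝ} (h : ∀ y, ‖v y‖ ≤ B) : Memℓp v ∞ :=
  memℓp_infty ⟨B, by rintro _ ⟨y, rfl⟩; exact h y⟩

/-- **The evaluation functional** `ev_y : ℓ^∞(Y, E) →L[ℝ] E`, `ev_y f = f y`, has norm `≤ 1` — the `ℓ` of ★ p850750 §4. [cite: HormanderALPDO1, §2.1] -/
theorem exists_eval_clm_lpInfty (y : Y) :
    ∃ ℓ : lp (fun _ : Y => E) ∞ →L[ℝ] E, ‖ℓ‖ ≤ 1 ∧ ∀ f : lp (fun _ : Y => E) ∞, ℓ f = f y := by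
  refine ⟨LinearMap.mkContinuous
    { toFun := fun f => f y
      map_add' := fun f g => by simp
      map_smul' := fun c f => by simp } 1 fun f => ?_, ?_, fun f => rfl⟩
  · rw [one_mul]
    exact lp.norm_apply_le_norm ENNReal.top_ne_zero f y
  · exact LinearMap.mkContinuous_norm_le _ zero_le_one _

omit [NormedAddCommGroup M] [NormedSpace ℝ M] [NormedSpace ℝ E] in
/-- **A family of maps `g : Y → M → E` bounded uniformly in `(y, x)` is ONE map `G : M → ℓ^∞(Y, E)`** with `G x y = g y x` and the norm read-back `‖G x‖ ≤ B₀` for every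
`B₀ ≥ 0` bounding the family. [cite: HormanderALPDO1, §2.1] -/
theorem exists_lpInfty_of_uniform_bound (g : Y → M → E) (B : ℝ) (h0 : ∀ y x, ‖g y x‖ ≤ B) :
    ∃ G : M → lp (fun _ : Y => E) ∞, (∀ x y, G x y = g y x) ∧
      ∀ B₀ : ℝ, 0 ≤ B₀ → (∀ y x, ‖g y x‖ ≤ B₀) → ∀ x, ‖G x‖ ≤ B₀ :=
  ⟨fun x => ⟨fun y => g y x, memℓp_infty_of_forall_norm_le fun y => h0 y x⟩, fun _ _ => rfl,
    fun _ hB₀ hg x => lp.norm_le_of_forall_le hB₀ fun y => hg y x⟩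

/-- **The slot swap** `Φ : ℓ^∞(Y, M →L[ℝ] E) →L[ℝ] (M →L[ℝ] ℓ^∞(Y, E))`, `Φ T h y = T y h`, of norm `≤ 1` (built with `LinearMap.mkContinuous`; no definition is
introduced). [cite: HormanderALPDO1, §2.1] -/
theorem exists_swap_clm_lpInfty :
    ∃ Φ : lp (fun _ : Y => (M →L[ℝ] E)) ∞ →L[ℝ] (M →L[ℝ] lp (fun _ : Y => E) ∞),
      ‖Φ‖ ≤ 1 ∧ ∀ (T : lp (fun _ : Y => (M →L[ℝ] E)) ∞) (h : M) (y : Y), Φ T h y = T y h := by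
  have hle : ∀ (T : lp (fun _ : Y => (M →L[ℝ] E)) ∞) (h : M) (y : Y), ‖(T y) h‖ ≤ ‖T‖ * ‖h‖ := fun T h y =>
    ((T y).le_opNorm h).trans (mul_le_mul_of_nonneg_right (lp.norm_apply_le_norm ENNReal.top_ne_zero T y) (norm_nonneg h))
  have hin : ∀ T : lp (fun _ : Y => (M →L[ℝ] E)) ∞, ∃ S : M →L[ℝ] lp (fun _ : Y => E) ∞, (∀ h y, S h y = T y h) ∧ ‖S‖ ≤ ‖T‖ := by
    intro T
    refine ⟨LinearMap.mkContinuous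
      { toFun := fun h => ⟨fun y => (T y) h, memℓp_infty_of_forall_norm_le fun y => hle T h y⟩
        map_add' := fun h h' => lp.ext (funext fun y => by simp)
        map_smul' := fun c h => lp.ext (funext fun y => by simp) } ‖T‖ fun h => ?_, fun h y => rfl, ?_⟩
    · exact lp.norm_le_of_forall_le (by positivity) fun y => hle T h y
    · exact LinearMap.mkContinuous_norm_le _ (norm_nonneg _) _
  choose S hS hSn using hin
  have hadd : ∀ T T' : lp (fun _ : Y => (M →L[ℝ] E)) ∞, S (T + T') = S T + S T' := fun T T' => by
    ext h y
    simp [hS]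
  have hsmul : ∀ (c : ℝ) (T : lp (fun _ : Y => (M →L[ℝ] E)) ∞), S (c • T) = c • S T := fun c T => by
    ext h y
    simp [hS]
  refine ⟨LinearMap.mkContinuous { toFun := S, map_add' := hadd, map_smul' := hsmul } 1 fun T => ?_,
    LinearMap.mkContinuous_norm_le _ zero_le_one _, fun T h y => hS T h y⟩
  rw [one_mul]
  exact hSn T

end Packaging

/-! ## §2 The second-order Taylor remainder from a bound on `‖D² f‖` -/

section Taylor

variable {M E : Type*} [NormedAddCommGroup M] [NormedSpace ℝ M] [NormedAddCommGroup E] [NormedSpace ℝ E]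

/-- **`Df` is `B₂`-Lipschitz** when `f ∈ C²` and `‖D² f‖ ≤ B₂` everywhere (mean value inequality for `Df`). [cite: Coleman2012, §3.2] -/
theorem norm_fderiv_sub_fderiv_le_of_norm_iteratedFDeriv_two_le {f : M → E} (hf : ContDiff ℝ 2 f) {B : ℝ}
    (hB : ∀ z, ‖iteratedFDeriv ℝ 2 f z‖ ≤ B) (x z : M) :
    ‖fderiv ℝ f z - fderiv ℝ f x‖ ≤ B * ‖z - x‖ := by
  have hdf' : Differentiable ℝ (fderiv ℝ f) := (hf.fderiv_right (m := 1) (by norm_num)).differentiable one_ne_zero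
  refine (convex_univ).norm_image_sub_le_of_norm_fderiv_le (fun w _ => hdf' w) (fun w _ => ?_) (mem_univ x) (mem_univ z)
  rw [← norm_iteratedFDeriv_zero (𝕜 := ℝ) (f := fderiv ℝ (fderiv ℝ f)), norm_iteratedFDeriv_fderiv, norm_iteratedFDeriv_fderiv]
  exact hB w

/-- **Second-order Taylor remainder, uniform form**: `f ∈ C²`, `‖D² f‖ ≤ B₂` everywhere ⇒ `‖f(x+h) − f(x) − Df(x) h‖ ≤ B₂ ‖h‖²` (mean value inequality for
`w ↦ f w − Df(x) w` on the ball `‖w − x‖ ≤ ‖h‖`, where its derivative `Df(w) − Df(x)` has norm `≤ B₂ ‖h‖`). [cite: HormanderALPDO1, Thm. 1.1.9] -/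
theorem norm_sub_sub_fderiv_le_of_norm_iteratedFDeriv_two_le {f : M → E} (hf : ContDiff ℝ 2 f) {B : ℝ}
    (hB : ∀ z, ‖iteratedFDeriv ℝ 2 f z‖ ≤ B) (x h : M) :
    ‖f (x + h) - f x - fderiv ℝ f x h‖ ≤ B * ‖h‖ ^ 2 := by
  have hB0 : 0 ≤ B := (norm_nonneg _).trans (hB x)
  have hdf : Differentiable ℝ f := hf.differentiable (by norm_num)
  have hφ : ∀ z ∈ Metric.closedBall x ‖h‖, ‖fderiv ℝ (fun w => f w - fderiv ℝ f x w) z‖ ≤ B * ‖h‖ := by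
    intro z hz
    rw [fderiv_fun_sub (hdf z) (fderiv ℝ f x).differentiableAt, ContinuousLinearMap.fderiv]
    exact (norm_fderiv_sub_fderiv_le_of_norm_iteratedFDeriv_two_le hf hB x z).trans
      (mul_le_mul_of_nonneg_left (mem_closedBall_iff_norm.1 hz) hB0)
  have hmv := (convex_closedBall x ‖h‖).norm_image_sub_le_of_norm_fderiv_le (𝕜 := ℝ) (f := fun w => f w - fderiv ℝ f x w)
    (fun z _ => (hdf z).sub (fderiv ℝ f x).differentiableAt) hφ (Metric.mem_closedBall_self (norm_nonneg h))
    (y := x + h) (by simp [Metric.mem_closedBall, dist_eq_norm])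
  calc ‖f (x + h) - f x - fderiv ℝ f x h‖ = ‖(f (x + h) - fderiv ℝ f x (x + h)) - (f x - fderiv ℝ f x x)‖ := by
        rw [map_add]; congr 1; abel
    _ ≤ B * ‖h‖ * ‖x + h - x‖ := hmv
    _ = B * ‖h‖ ^ 2 := by rw [add_sub_cancel_left, sq, mul_assoc]

end Taylor

/-! ## §3 The graded engine and the heads -/

section Engine

variable {Y M : Type u} [NormedAddCommGroup M] [NormedSpace ℝ M]

/-- **GRADED ENGINE**: if each `g y ∈ C^{n+1}(M, E)` and the jets of orders `≤ n+1` are bounded UNIFORMLY in `(y, x)`, then the packaged map `G : M → ℓ^∞(Y, E)`, `G x y = g y x`,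
is of class `Cⁿ`.  Induction on `n`, universally in the target `E` (the derivative family `y ↦ Dg_y` is again such a family, with values in `M →L[ℝ] E`, Mathlib
`norm_iteratedFDeriv_fderiv`): `G` is differentiable with `fderiv G x = Φ (Ĝ′ x)` (§1 slot swap, §2 uniform Taylor remainder `≤ B₂‖h‖²`), and Mathlib
`contDiff_succ_iff_hasFDerivAt` closes the step. [cite: HormanderALPDO1, Thm. 1.1.9] -/
theorem exists_contDiff_lpInfty_of_uniform_bounds (n : ℕ) :
    ∀ (E : Type u) [NormedAddCommGroup E] [NormedSpace ℝ E] (g : Y → M → E),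
      (∀ y, ContDiff ℝ (n + 1) (g y)) → (∀ k ≤ n + 1, ∃ B : ℝ, ∀ y x, ‖iteratedFDeriv ℝ k (g y) x‖ ≤ B) →
      ∃ G : M → lp (fun _ : Y => E) ∞, (∀ x y, G x y = g y x) ∧ ContDiff ℝ n G := by
  induction n with
  | zero =>
    intro E _ _ g hg hbd
    obtain ⟨B0, hB0⟩ := hbd 0 (by omega)
    obtain ⟨B1, hB1⟩ := hbd 1 (by omega)
    obtain ⟨G, hG, -⟩ := exists_lpInfty_of_uniform_bound g B0 fun y x => by simpa [norm_iteratedFDeriv_zero] using hB0 y x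
    refine ⟨G, hG, ?_⟩
    have hlip : ∀ x x', ‖G x - G x'‖ ≤ max B1 0 * ‖x - x'‖ := by
      intro x x'
      refine lp.norm_le_of_forall_le (by positivity) fun y => ?_
      have hdiff : ∀ z ∈ (univ : Set M), DifferentiableAt ℝ (g y) z := fun z _ => ((hg y).differentiable (by simp)).differentiableAt
      have hbound : ∀ z ∈ (univ : Set M), ‖fderiv ℝ (g y) z‖ ≤ max B1 0 := fun z _ => by
        rw [← norm_iteratedFDeriv_zero (𝕜 := ℝ) (f := fderiv ℝ (g y)), norm_iteratedFDeriv_fderiv]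
        exact (hB1 y z).trans (le_max_left _ _)
      have hmv := (convex_univ).norm_image_sub_le_of_norm_fderiv_le hdiff hbound (mem_univ x') (mem_univ x)
      simpa only [lp.coeFn_sub, Pi.sub_apply, hG] using hmv
    have hK : LipschitzWith (max B1 0).toNNReal G := LipschitzWith.of_dist_le' fun x x' => by
      simpa only [dist_eq_norm] using hlip x x'
    simpa using hK.continuous
  | succ n ih =>
    intro E _ _ g hg hbd
    -- the derivative family, packaged by the induction hypothesis
    have hd : ∀ y, ContDiff ℝ (n + 1) (fun x => fderiv ℝ (g y) x) := fun y =>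
      (hg y).fderiv_right (by push_cast; exact le_rfl)
    have hdb : ∀ k ≤ n + 1, ∃ B : ℝ, ∀ y x, ‖iteratedFDeriv ℝ k (fun x => fderiv ℝ (g y) x) x‖ ≤ B := fun k hk => by
      obtain ⟨B, hB⟩ := hbd (k + 1) (by omega)
      exact ⟨B, fun y x => by rw [show (fun x => fderiv ℝ (g y) x) = fderiv ℝ (g y) from rfl, norm_iteratedFDeriv_fderiv]; exact hB y x⟩
    obtain ⟨D, hD, hDn⟩ := ih (M →L[ℝ] E) (fun y x => fderiv ℝ (g y) x) hd hdb
    obtain ⟨B0, hB0⟩ := hbd 0 (by omega)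
    obtain ⟨B2, hB2⟩ := hbd 2 (by omega)
    obtain ⟨G, hG, -⟩ := exists_lpInfty_of_uniform_bound g B0 fun y x => by simpa [norm_iteratedFDeriv_zero] using hB0 y x
    obtain ⟨Φ, -, hΦ⟩ := exists_swap_clm_lpInfty (Y := Y) (M := M) (E := E)
    refine ⟨G, hG, ?_⟩
    have h2 : ∀ y, ContDiff ℝ 2 (g y) := fun y => (hg y).of_le (by push_cast; exact_mod_cast (by omega : 2 ≤ n + 1 + 1))
    have hderiv : ∀ x, HasFDerivAt G (Φ (D x)) x := by
      intro x
      rw [hasFDerivAt_iff_isLittleO_nhds_zero]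
      have hR : ∀ h : M, ‖G (x + h) - G x - Φ (D x) h‖ ≤ max B2 0 * ‖h‖ ^ 2 := by
        intro h
        refine lp.norm_le_of_forall_le (by positivity) fun y => ?_
        have hcomp : (G (x + h) - G x - Φ (D x) h) y = g y (x + h) - g y x - fderiv ℝ (g y) x h := by
          simp only [lp.coeFn_sub, Pi.sub_apply, hG, hΦ, hD]
        rw [hcomp]
        exact (norm_sub_sub_fderiv_le_of_norm_iteratedFDeriv_two_le (h2 y) (fun z => hB2 y z) x h).trans
          (mul_le_mul_of_nonneg_right (le_max_left _ _) (by positivity))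
      refine IsBigO.trans_isLittleO ?_ (isLittleO_norm_pow_id (E' := M) one_lt_two)
      exact IsBigO.of_bound (max B2 0) (Eventually.of_forall fun h => by rw [norm_pow, norm_norm]; exact hR h)
    push_cast
    exact contDiff_succ_iff_hasFDerivAt.2 ⟨fun x => Φ (D x), Φ.contDiff.comp hDn, hderiv⟩

end Engine

section Heads

variable {Y M E : Type u} [NormedAddCommGroup M] [NormedSpace ℝ M] [NormedAddCommGroup E] [NormedSpace ℝ E]

/-- **`C^∞` form**: each `g y ∈ C^∞` with jets of every order bounded uniformly in `(y, x)` ⇒ the packaged `G : M → ℓ^∞(Y, E)` is `C^∞`, with the norm read-back and the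
evaluations `ev_y ∘ G = g y` (`‖ev_y‖ ≤ 1`). [cite: HormanderALPDO1, Thm. 1.1.9] -/
theorem exists_contDiff_lpInfty_of_uniform_bounds_infty (g : Y → M → E) (hg : ∀ y, ContDiff ℝ ∞ (g y))
    (hbd : ∀ n : ℕ, ∃ B : ℝ, ∀ y x, ‖iteratedFDeriv ℝ n (g y) x‖ ≤ B) :
    ∃ G : M → lp (fun _ : Y => E) ∞, (∀ x y, G x y = g y x) ∧ ContDiff ℝ ∞ G ∧
      (∀ B₀ : ℝ, 0 ≤ B₀ → (∀ y x, ‖g y x‖ ≤ B₀) → ∀ x, ‖G x‖ ≤ B₀) ∧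
      ∀ y, ∃ ℓ : lp (fun _ : Y => E) ∞ →L[ℝ] E, ‖ℓ‖ ≤ 1 ∧ ∀ x, ℓ (G x) = g y x := by
  obtain ⟨B0, hB0⟩ := hbd 0
  obtain ⟨G, hG, hGn⟩ := exists_lpInfty_of_uniform_bound g B0 fun y x => by simpa [norm_iteratedFDeriv_zero] using hB0 y x
  refine ⟨G, hG, ?_, hGn, fun y => ?_⟩
  · rw [contDiff_infty]
    intro n
    obtain ⟨G', hG', hG'n⟩ := exists_contDiff_lpInfty_of_uniform_bounds (Y := Y) (M := M) n E g
      (fun y => (hg y).of_le (by exact_mod_cast le_top)) (fun k _ => hbd k)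
    have hGG : G' = G := funext fun x => lp.ext (funext fun y => by rw [hG', hG])
    rwa [hGG] at hG'n
  · obtain ⟨ℓ, hℓ, hℓf⟩ := exists_eval_clm_lpInfty (E := E) y
    exact ⟨ℓ, hℓ, fun x => by rw [hℓf, hG]⟩

/-- **HEAD — a `C^∞`-bounded family `Y → C_c^∞_K(M, E)` is ONE `C_c^∞` map `M → ℓ^∞(Y, E)`**: each `g y ∈ C^∞`, jets of every order bounded uniformly in `(y, x)`, all `g y`
vanishing off one compact `K` ⇒ `G : M → ℓ^∞(Y, E)` with `G x y = g y x`, `ContDiff ℝ ∞ G`, `HasCompactSupport G`, the norm read-back, and `ev_y ∘ G = g y` with `‖ev_y‖ ≤ 1`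
— so ★ p850750 §4 at `E′ := ℓ^∞(Y, E)` gives ONE punctured neighbourhood and ONE constant for the whole family. [cite: HormanderALPDO1, §2.1] -/
theorem exists_contDiff_hasCompactSupport_lpInfty_of_uniform_bounds (g : Y → M → E) (hg : ∀ y, ContDiff ℝ ∞ (g y))
    (hbd : ∀ n : ℕ, ∃ B : ℝ, ∀ y x, ‖iteratedFDeriv ℝ n (g y) x‖ ≤ B) {K : Set M} (hK : IsCompact K)
    (hsupp : ∀ y x, x ∉ K → g y x = 0) :
    ∃ G : M → lp (fun _ : Y => E) ∞, (∀ x y, G x y = g y x) ∧ ContDiff ℝ ∞ G ∧ HasCompactSupport G ∧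
      (∀ B₀ : ℝ, 0 ≤ B₀ → (∀ y x, ‖g y x‖ ≤ B₀) → ∀ x, ‖G x‖ ≤ B₀) ∧
      ∀ y, ∃ ℓ : lp (fun _ : Y => E) ∞ →L[ℝ] E, ‖ℓ‖ ≤ 1 ∧ ∀ x, ℓ (G x) = g y x := by
  obtain ⟨G, hG, hGs, hGn, hev⟩ := exists_contDiff_lpInfty_of_uniform_bounds_infty g hg hbd
  refine ⟨G, hG, hGs, ?_, hGn, hev⟩
  exact HasCompactSupport.intro hK fun x hx => lp.ext (funext fun y => by simp [hG, hsupp y x hx])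

/-- **Bounds on `K ⊇ tsupport (g y)` suffice**: if every `g y` has `tsupport (g y) ⊆ K` and the jets are bounded on `K` uniformly in `y`, they are bounded everywhere (a jet
vanishes off the topological support, Mathlib `tsupport_iteratedFDeriv_subset`). [cite: HormanderALPDO1, §2.1] -/
theorem exists_uniform_bounds_of_tsupport_subset (g : Y → M → E) {K : Set M} (hsupp : ∀ y, tsupport (g y) ⊆ K)
    (hbd : ∀ n : ℕ, ∃ B : ℝ, ∀ y, ∀ x ∈ K, ‖iteratedFDeriv ℝ n (g y) x‖ ≤ B) (n : ℕ) :
    ∃ B : ℝ, ∀ y x, ‖iteratedFDeriv ℝ n (g y) x‖ ≤ B := by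
  obtain ⟨B, hB⟩ := hbd n
  refine ⟨max B 0, fun y x => ?_⟩
  by_cases hx : x ∈ K
  · exact (hB y x hx).trans (le_max_left _ _)
  · have hx' : x ∉ tsupport (iteratedFDeriv ℝ n (g y)) := fun h => hx (hsupp y (tsupport_iteratedFDeriv_subset n h))
    rw [image_eq_zero_of_notMem_tsupport hx', norm_zero]
    exact le_max_right _ _

/-- **HEAD, `K`-local hypotheses**: each `g y ∈ C^∞` with `tsupport (g y) ⊆ K`, `K` compact, and jets of every order bounded ON `K` uniformly in `y` ⇒ the conclusions of ★
`exists_contDiff_hasCompactSupport_lpInfty_of_uniform_bounds`. [cite: HormanderALPDO1, §2.1] -/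
theorem exists_contDiff_hasCompactSupport_lpInfty_of_bounds_on (g : Y → M → E) (hg : ∀ y, ContDiff ℝ ∞ (g y)) {K : Set M} (hK : IsCompact K)
    (hsupp : ∀ y, tsupport (g y) ⊆ K) (hbd : ∀ n : ℕ, ∃ B : ℝ, ∀ y, ∀ x ∈ K, ‖iteratedFDeriv ℝ n (g y) x‖ ≤ B) :
    ∃ G : M → lp (fun _ : Y => E) ∞, (∀ x y, G x y = g y x) ∧ ContDiff ℝ ∞ G ∧ HasCompactSupport G ∧
      (∀ B₀ : ℝ, 0 ≤ B₀ → (∀ y x, ‖g y x‖ ≤ B₀) → ∀ x, ‖G x‖ ≤ B₀) ∧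
      ∀ y, ∃ ℓ : lp (fun _ : Y => E) ∞ →L[ℝ] E, ‖ℓ‖ ≤ 1 ∧ ∀ x, ℓ (G x) = g y x :=
  exists_contDiff_hasCompactSupport_lpInfty_of_uniform_bounds g hg (exists_uniform_bounds_of_tsupport_subset g hsupp hbd) hK
    fun y _ hx => image_eq_zero_of_notMem_tsupport fun h => hx (hsupp y h)

end Heads

end Literature.Analysis.Calculus

end
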